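import Literature.Geometry.Hyperkaehler.KaehlerFormsAdjointRepresentation
import Literature.Geometry.Hyperkaehler.IsotropyGroupInvariance
import Literature.Geometry.Symplectic.WedgeTwoTwoApply
import Literature.Geometry.Kaehler.ComplexTorusHardLefschetz
import Literature.Geometry.Kaehler.SymplecticInvariantForms
import Literature.Geometry.Kaehler.TwoFormTransgression
import HarnessLib

/-!
# The square `ω_I ∧ ω_I` of a Kähler form is NOT invariant under the isotropy group `G_M = SU(2)` of a
# hyperkähler structure as soon as the quaternionic dimension is `≥ 2` (Verbitsky 1996 §1–§2, degree `4`),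
# pointwise

Topic `Literature/Geometry/Hyperkaehler`, namespace `Literature.Geometry.Hyperkaehler.IsLinearHyperkaehler`
(carrier `IsLinearHyperkaehler g₀ J` of `ComplexTorusHyperkaehler.lean`: a complex normed space `E` with `I = i•`, a
second complex structure `J` anticommuting with `I`, `K = IJ`, a positive definite `g₀` invariant under `I` and `J`;
fundamental forms `ω_A = fundamentalForm g₀ A`). Verbitsky's `ad T` on `k`-covectors is `adAlt T`
(`LinearAlgebra/Alternating/DerivationExtension.lean`); "`G_M`-invariant" for a `k`-covector `β` is rendered, as in
`IsotropyAlgebraAction.lean`, by `ad I β = 0 ∧ ad J β = 0`, which `IsotropyGroupInvariance.lean`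
(`forall_compContinuousLinearMap_quaternion_iff`) proves equivalent to invariance under every unit quaternion
`q = a + bI + cJ + dK` acting diagonally. Written by the literature seat `lit-w-verbitsky` of the cell `pub-hsemireg`
(HodgeConjecture venture), 2026-08-23.

## Source, verbatim (M. Verbitsky, *Hyperholomorphic bundles over a hyperkähler manifold*, J. Alg. Geom. 5 (1996)
633–669 = alg-geom/9307008, arXiv numbering; held corpus text `paper:arxiv-alg-geom_9307008` p0002 L36–L50, p0003
L20–L56)

* Prop. 1.2: "Let `ω` be a differential form over a hyperkähler manifold `M`. The form `ω` is `G_M`-invariant if and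
  only if it is of Hodge type `(p,p)` with respect to all induced complex structures on `M`."
* Lemma 2.1, proof: "Consider the bundle `R ⊂ Λ²(M) ⊗ End(B)` spanned by the Kähler forms `ω_L`, for all induced
  complex structures `L` on `M`. The element of a group `G_M` maps each of these forms into a linear combination of
  these forms. […] Moreover, no section of `R` is `G_M`-invariant. This is proven by another direct computation.
  Both of these computations are based on the fact that `R` is a trivial bundle over `M` with a fiber `𝔤_M`, and
  `G_M` acts on `R` by means of adjoint representation on `𝔤_M`."

`KaehlerFormsAdjointRepresentation.lean` formalises these two "direct computations" in degree `2`
(`ad J ω_I = 2 ω_K`, …, and "no non-zero vector of `R = span{ω_I, ω_J, ω_K}` is `𝔤_M`-trivial"). This file is the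
same direct computation ONE DEGREE UP, for the square of the Kähler form — the representative of the square
`[ω_I]² = h²` of a polarisation class on a flat complex torus `E/Λ` with a compatible flat hyperkähler metric, where
`H⁴(E/Λ, ℝ) = Λ⁴E^*` consists of the constant forms and the `G_M`-action on cohomology is the pointwise one.

## What is formalised (theorems only; no definition, no named fact, no `sorry`)

With `ω_I = fundamentalForm g₀ (opI E)`, `ω_K = fundamentalForm g₀ (opK J)` and `h : IsLinearHyperkaehler g₀ J`:

* `adAlt_J_wedge_self_fundamentalForm_opI` — Leibniz + `ad J ω_I = 2ω_K`:
  `ad J (ω_I ∧ ω_I) = 2 (ω_K ∧ ω_I) + 2 (ω_I ∧ ω_K)`; and `adAlt_opI_wedge_self_fundamentalForm_opI`: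
  `ad I (ω_I ∧ ω_I) = 0` (`ω_I ∧ ω_I` IS of type `(2,2)` for `I` itself).
* `wedge_fundamentalForm_opI_opK_apply_hOrthogonal` / `wedge_fundamentalForm_opK_opI_apply_hOrthogonal` — on the
  frame `(v, Iv, w, Kw)` of two vectors with `w` `g₀`-orthogonal to the quaternionic line `ℍv = span{v, Iv, Jv, Kv}`:
  `(ω_I ∧ ω_K)(v, Iv, w, Kw) = (ω_K ∧ ω_I)(v, Iv, w, Kw) = g₀(v,v) g₀(w,w)` (the six `(2,2)`-shuffles,
  `ContinuousAlternatingMap.wedge_apply_two_two`).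
* **`adAlt_J_wedge_self_fundamentalForm_opI_apply_hOrthogonal`**: `(ad J (ω_I ∧ ω_I))(v, Iv, w, Kw) = 4 g₀(v,v) g₀(w,w)`,
  hence **`adAlt_J_wedge_self_fundamentalForm_opI_ne_zero`**: `ad J (ω_I ∧ ω_I) ≠ 0` whenever such `v, w ≠ 0` exist,
  i.e. whenever the quaternionic dimension is `≥ 2`.
* (private) `exists_ne_zero_hOrthogonal`: if `4 < finrank_ℝ E`, every `v` has a non-zero `w` orthogonal to `ℍv` (rank–nullity
  for `w ↦ (g₀(v,w), g₀(Iv,w), g₀(Jv,w), g₀(Kv,w)) ∈ ℝ⁴`); whence the headline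
  **`adAlt_J_wedge_self_fundamentalForm_opI_ne_zero_of_finrank`**: for `finrank_ℝ E > 4` (real dimension `4m`,
  `m ≥ 2`), `ad J (ω_I ∧ ω_I) ≠ 0` — **`ω_I ∧ ω_I` is not `𝔤_M`-trivial** (`not_su2Trivial_wedge_self_fundamentalForm_opI`:
  `¬ (ad I (ω_I∧ω_I) = 0 ∧ ad J (ω_I∧ω_I) = 0)`) and, at the group level
  (**`not_forall_quaternion_invariant_wedge_self_fundamentalForm_opI`**), NOT invariant under all unit quaternions:
  `¬ ∀ q ∈ SU(2), q^*(ω_I ∧ ω_I) = ω_I ∧ ω_I`.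

* §4, ANY KÄHLER CLASS (`[FiniteDimensional ℂ E]`, `3 ≤ finrank_ℂ E`): `eq_zero_of_two_wedge_two_eq_zero` — for a
  non-degenerate real `2`-form `h`, `h ∧ η = 0 ⟹ η = 0` on real `2`-forms (the tree's pointwise hard Lefschetz
  `Kaehler.ComplexTorus.eq_zero_of_wedgePow_wedge_eq_zero`, `k = 2`, `j = dim − 2`, plus associativity
  `WedgeAssoc_holds`); **`adAlt_wedge_self_ne_zero_of_oneOne_pos`**: for `J² = −1`, `JI = −IJ` and ANY real `2`-form
  `h` with `h(v, Iv) > 0` (`v ≠ 0`) — e.g. any positive `(1,1)`-form, i.e. any Kähler class of a flat torus —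
  `ad J (h ∧ h) ≠ 0` (Leibniz gives `ad J (h∧h) = 2 h ∧ ad J h`; Lefschetz forces `ad J h = 0`, i.e. `h(J·,J·) = h`;
  then `h(Jv, I Jv) = −h(v, Iv) < 0` contradicts positivity at `Jv`); and on the carrier of `IsLinearHyperkaehler g₀ J`:
  **`not_su2Trivial_wedge_self_of_oneOne_pos`**, **`not_forall_quaternion_invariant_wedge_self_of_oneOne_pos`**
  (`h ∧ h` is not `𝔤_M`-trivial, not `SU(2)`-invariant), `adAlt_J_wedge_self_fundamentalForm_opI_ne_zero_of_finrank_complex`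
  (§3 as the case `h = ω_I`).
* §5: `adAlt_wedge_eq_zero_of_eq_zero` (products of `ad T`-trivial forms are `ad T`-trivial — Chern forms of a
  `𝔤_M`-trivial curvature are `𝔤_M`-trivial) and **`eq_zero_of_adAlt_smul_wedge_self_eq_zero`** /
  `IsLinearHyperkaehler.eq_zero_of_forall_quaternion_invariant_smul_wedge_self`: an `ad J`-trivial (resp.
  `SU(2)`-invariant) real multiple `c • h ∧ h` has `c = 0` — the shape in which the sub-lemma is applied.
* §6 (degree `2`, any non-zero `E`): `adAlt_ne_zero_of_pos` (`ad J h ≠ 0` for `I`-positive `h`) and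
  `IsLinearHyperkaehler.not_forall_quaternion_invariant_of_pos` (no `I`-positive `2`-form — no Kähler class — is
  `SU(2)`-invariant): the `H²`-shadow, Lemma 2.1's "no section of `R` is `G_M`-invariant" for every Kähler class.

For `m = 1` (`E ≅ ℍ`) the statement is false — `ω_I ∧ ω_I = ω_J ∧ ω_J = ω_K ∧ ω_K` is twice the volume form and
`ω_I ∧ ω_K = 0` — which is why a second quaternionic direction `w` (§2–§3), resp. `dim_ℂ ≥ 3` for Lefschetz on
`2`-forms (§4), is exactly what the proofs use.

SCOPE NOTES (faithfulness). (i) Pointwise linear algebra on one quaternionic Hermitian vector space; this is the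
cohomological statement verbatim only for flat compact tori (constant forms = cohomology), which is the use the
`pub-hsemireg` cell makes of it ("`[h²]` is not `SU(2)_g`-invariant for any hyperkähler `g` inducing `I`, any
Kähler class `h`, `m ≥ 2`" — the positivity step of its lemma that a hyperholomorphic bundle on a complex torus of
dimension `2m ≥ 4` with `c₂ ∈ ℝh²` has `c₂(End) = 0`; §4 is that step for every `h` and every `(g, J)`, §3 the
case `h = ω_g`); the identification "de Rham cohomology of a flat torus = constant forms, equivariantly" is NOT
formalised here;
for a general compact hyperkähler manifold the passage from forms to classes is Verbitsky's Prop. 1.1 ("the action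
is parallel, and therefore it commutes with Laplace operator"), not formalised in the tree. (ii) The source prints
the degree-`2` statement (Lemma 2.1's proof) and the general criterion (Prop. 1.2); the degree-`4` instance is a
direct computation from them and is labelled `[folklore]` where no printed sentence states it. (iii) Signs follow
`DerivationExtension.lean` (`ad J ω_I = +2ω_K` in the tree's convention); only non-vanishing is asserted, so the
convention is immaterial.

## References

* [Verbitsky1996Hyperholomorphic] M. Verbitsky, J. Alg. Geom. 5 (1996) 633–669 = alg-geom/9307008 (arXiv
  numbering), §1 Prop. 1.2; §2 Lemma 2.1 and its proof (read, held corpus text p0002–p0003).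
* [Joyce2007] D. Joyce, *Riemannian Holonomy Groups and Calibrated Geometry* (2007), §10.1.1 eq. (10.1) (the
  triple `ω₁, ω₂, ω₃` on `ℍ^m`; the tree's `fundamentalForm`).
* [Warner1983] F. W. Warner, *Foundations of Differentiable Manifolds and Lie Groups* (1983), 2.10(b) (the
  shuffle formula; the tree's `wedge_apply_two_two`).
* [Voisin2002] C. Voisin, *Hodge Theory and Complex Algebraic Geometry I* (2002), Lemma 6.20 (pointwise hard
  Lefschetz; the tree's `Kaehler.ComplexTorus.eq_zero_of_wedgePow_wedge_eq_zero`).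
* [Lange2023AbelianVarietiesComplex] H. Lange, *Abelian Varieties over the Complex Numbers* (2023), §7.3.2 (1)
  (hard Lefschetz for the constant forms of a complex torus).
-/

noncomputable section

open Complex Function Literature.LinearAlgebra.Alternating

namespace Literature.Geometry.Hyperkaehler

namespace IsLinearHyperkaehler

variable {E : Type*} [NormedAddCommGroup E] [NormedSpace ℂ E]
  {g₀ : E →L[ℝ] E →L[ℝ] ℝ} {J : E →L[ℝ] E}

/-! ## §1 Leibniz: `ad J (ω_I ∧ ω_I) = 2 ω_K ∧ ω_I + 2 ω_I ∧ ω_K`, `ad I (ω_I ∧ ω_I) = 0` -/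

/-- **`ad J (ω_I ∧ ω_I) = 2 (ω_K ∧ ω_I) + 2 (ω_I ∧ ω_K)`**: Verbitsky's `ad` is a derivation ("We extend it on
`i`-forms for arbitrary `i` using Leibnitz formula") and `ad J ω_I = 2ω_K` (the adjoint representation on
`R = span{ω_I, ω_J, ω_K}`). [cite: Verbitsky1996Hyperholomorphic, §1 (definition of ad I) and §2 Lemma 2.1 (proof)] -/
theorem adAlt_J_wedge_self_fundamentalForm_opI (h : IsLinearHyperkaehler g₀ J) :
    adAlt J ((fundamentalForm g₀ (opI E)).wedge (fundamentalForm g₀ (opI E))) =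
      (2 : ℝ) • (fundamentalForm g₀ (opK J)).wedge (fundamentalForm g₀ (opI E)) +
        (2 : ℝ) • (fundamentalForm g₀ (opI E)).wedge (fundamentalForm g₀ (opK J)) := by
  rw [adAlt_wedge, h.adAlt_J_fundamentalForm_opI, ContinuousAlternatingMap.wedge_smul_left,
    ContinuousAlternatingMap.wedge_smul_right]

/-- **`ad I (ω_I ∧ ω_I) = 0`**: the square of the Kähler form is of type `(2,2)` for its own complex structure
(`ad I ω_I = 0` and Leibniz). [cite: Verbitsky1996Hyperholomorphic, §1 Prop. 1.2 (proof: "ad L(ω) = (p−q)√−1 ω")] -/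
theorem adAlt_opI_wedge_self_fundamentalForm_opI (h : IsLinearHyperkaehler g₀ J) :
    adAlt (opI E) ((fundamentalForm g₀ (opI E)).wedge (fundamentalForm g₀ (opI E))) = 0 := by
  rw [adAlt_wedge, h.adAlt_opI_fundamentalForm_opI, ContinuousAlternatingMap.zero_wedge,
    ContinuousAlternatingMap.wedge_zero, add_zero]

/-! ## §2 The direct computation on the frame `(v, Iv, w, Kw)`, `w ⊥ ℍv` -/

/-- **`(ω_I ∧ ω_K)(v, Iv, w, IJw) = g₀(v,v) g₀(w,w)`** for `w` orthogonal (for `g₀`) to `v, Iv, Jv, IJv`: of the six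
shuffle terms only `ω_I(v, Iv) ω_K(w, IJw)` survives. [folklore] [cite: Warner1983, 2.10(b)] -/
theorem wedge_fundamentalForm_opI_opK_apply_hOrthogonal (h : IsLinearHyperkaehler g₀ J) {v w : E}
    (hvw : g₀ v w = 0) (hIvw : g₀ (I • v) w = 0) (hJvw : g₀ (J v) w = 0) (hKvw : g₀ (I • J v) w = 0) :
    (fundamentalForm g₀ (opI E)).wedge (fundamentalForm g₀ (opK J)) ![v, I • v, w, I • J w] =
      g₀ v v * g₀ w w := by
  rw [ContinuousAlternatingMap.wedge_apply_two_two]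
  have a1 : fundamentalForm g₀ (opI E) ![v, I • v] = g₀ v v := by
    rw [h.fundamentalForm_I_apply, h.inner_I]
  have a2 : fundamentalForm g₀ (opI E) ![v, w] = 0 := by
    rw [h.fundamentalForm_I_apply, hIvw]
  have a3 : fundamentalForm g₀ (opI E) ![I • v, w] = 0 := by
    rw [h.fundamentalForm_I_apply, smul_smul, Complex.I_mul_I, neg_one_smul, map_neg,
      neg_apply, hvw, neg_zero]
  have a4 : fundamentalForm g₀ (opK J) ![w, I • J w] = g₀ w w := by
    rw [h.fundamentalForm_K_apply, h.inner_K]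
  have a5 : fundamentalForm g₀ (opK J) ![v, I • v] = 0 := by
    rw [h.fundamentalForm_K_apply, h.inner_I]
    have h1 := h.inner_J_left v v
    have h2 := h.symm (J v) v
    linarith
  have a6 : fundamentalForm g₀ (opK J) ![v, w] = 0 := by
    rw [h.fundamentalForm_K_apply, hKvw]
  have a7 : fundamentalForm g₀ (opK J) ![I • v, w] = 0 := by
    rw [h.fundamentalForm_K_apply, h.I_J_I, hJvw]
  rw [a1, a4, a2, a7, a5, a6, a3]
  ring

/-- **`(ω_K ∧ ω_I)(v, Iv, w, IJw) = g₀(v,v) g₀(w,w)`** on the same frame (only `ω_K(w, IJw) ω_I(v, Iv)` survives).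
[folklore] [cite: Warner1983, 2.10(b)] -/
theorem wedge_fundamentalForm_opK_opI_apply_hOrthogonal (h : IsLinearHyperkaehler g₀ J) {v w : E}
    (hvw : g₀ v w = 0) (hIvw : g₀ (I • v) w = 0) (hJvw : g₀ (J v) w = 0) (hKvw : g₀ (I • J v) w = 0) :
    (fundamentalForm g₀ (opK J)).wedge (fundamentalForm g₀ (opI E)) ![v, I • v, w, I • J w] =
      g₀ v v * g₀ w w := by
  rw [ContinuousAlternatingMap.wedge_apply_two_two]
  have a1 : fundamentalForm g₀ (opI E) ![v, I • v] = g₀ v v := by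
    rw [h.fundamentalForm_I_apply, h.inner_I]
  have a2 : fundamentalForm g₀ (opI E) ![v, w] = 0 := by
    rw [h.fundamentalForm_I_apply, hIvw]
  have a3 : fundamentalForm g₀ (opI E) ![I • v, w] = 0 := by
    rw [h.fundamentalForm_I_apply, smul_smul, Complex.I_mul_I, neg_one_smul, map_neg,
      neg_apply, hvw, neg_zero]
  have a4 : fundamentalForm g₀ (opK J) ![w, I • J w] = g₀ w w := by
    rw [h.fundamentalForm_K_apply, h.inner_K]
  have a5 : fundamentalForm g₀ (opK J) ![v, I • v] = 0 := by
    rw [h.fundamentalForm_K_apply, h.inner_I]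
    have h1 := h.inner_J_left v v
    have h2 := h.symm (J v) v
    linarith
  have a6 : fundamentalForm g₀ (opK J) ![v, w] = 0 := by
    rw [h.fundamentalForm_K_apply, hKvw]
  have a7 : fundamentalForm g₀ (opK J) ![I • v, w] = 0 := by
    rw [h.fundamentalForm_K_apply, h.I_J_I, hJvw]
  rw [a5, a6, a3, a4, a1, a2, a7]
  ring

/-- **`(ad J (ω_I ∧ ω_I))(v, Iv, w, IJw) = 4 g₀(v,v) g₀(w,w)`** for `w ⊥ ℍv`. [folklore]
[cite: Verbitsky1996Hyperholomorphic, §2 Lemma 2.1 (proof: adjoint representation on 𝔤_M)] -/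
theorem adAlt_J_wedge_self_fundamentalForm_opI_apply_hOrthogonal (h : IsLinearHyperkaehler g₀ J) {v w : E}
    (hvw : g₀ v w = 0) (hIvw : g₀ (I • v) w = 0) (hJvw : g₀ (J v) w = 0) (hKvw : g₀ (I • J v) w = 0) :
    adAlt J ((fundamentalForm g₀ (opI E)).wedge (fundamentalForm g₀ (opI E))) ![v, I • v, w, I • J w] =
      4 * (g₀ v v * g₀ w w) := by
  rw [h.adAlt_J_wedge_self_fundamentalForm_opI, ContinuousAlternatingMap.add_apply,
    ContinuousAlternatingMap.smul_apply, ContinuousAlternatingMap.smul_apply,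
    h.wedge_fundamentalForm_opK_opI_apply_hOrthogonal hvw hIvw hJvw hKvw,
    h.wedge_fundamentalForm_opI_opK_apply_hOrthogonal hvw hIvw hJvw hKvw, smul_eq_mul]
  ring

/-- **`ad J (ω_I ∧ ω_I) ≠ 0` as soon as there are two non-zero vectors `v, w` with `w ⊥ ℍv`** (quaternionic
dimension `≥ 2`): `ω_I ∧ ω_I` is not of type `(2,2)` for the induced complex structure `J`, hence (Prop. 1.2) not
`G_M`-invariant. [folklore] [cite: Verbitsky1996Hyperholomorphic, §1 Prop. 1.2 and §2 Lemma 2.1 (proof)] -/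
theorem adAlt_J_wedge_self_fundamentalForm_opI_ne_zero (h : IsLinearHyperkaehler g₀ J) {v w : E} (hv : v ≠ 0)
    (hw : w ≠ 0) (hvw : g₀ v w = 0) (hIvw : g₀ (I • v) w = 0) (hJvw : g₀ (J v) w = 0)
    (hKvw : g₀ (I • J v) w = 0) :
    adAlt J ((fundamentalForm g₀ (opI E)).wedge (fundamentalForm g₀ (opI E))) ≠ 0 := by
  intro h0
  have e := h.adAlt_J_wedge_self_fundamentalForm_opI_apply_hOrthogonal hvw hIvw hJvw hKvw
  rw [h0, ContinuousAlternatingMap.coe_zero, Pi.zero_apply] at e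
  have hv' := h.pos v hv
  have hw' := h.pos w hw
  nlinarith [mul_pos hv' hw']

/-! ## §3 Quaternionic dimension `≥ 2` as `finrank_ℝ E > 4` -/

/-- In real dimension `> 4`, every vector `v` admits a non-zero `w` orthogonal (for `g₀`) to the quaternionic line
`span{v, Iv, Jv, IJv}` (rank–nullity for `w ↦ (g₀(v,w), g₀(Iv,w), g₀(Jv,w), g₀(IJv,w))`; private plumbing). [folklore] -/
private theorem exists_ne_zero_hOrthogonal [FiniteDimensional ℝ E] (hdim : 4 < Module.finrank ℝ E) (v : E) :
    ∃ w : E, w ≠ 0 ∧ g₀ v w = 0 ∧ g₀ (I • v) w = 0 ∧ g₀ (J v) w = 0 ∧ g₀ (I • J v) w = 0 := by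
  let u : Fin 4 → E := ![v, I • v, J v, I • J v]
  let f : E →ₗ[ℝ] (Fin 4 → ℝ) := LinearMap.pi fun i ↦ ((g₀ (u i) : E →L[ℝ] ℝ) : E →ₗ[ℝ] ℝ)
  have hrange : Module.finrank ℝ (LinearMap.range f) ≤ 4 :=
    (Submodule.finrank_le _).trans_eq (Module.finrank_fin_fun ℝ)
  have hker : 0 < Module.finrank ℝ (LinearMap.ker f) := by
    have e := LinearMap.finrank_range_add_finrank_ker f
    omega
  obtain ⟨⟨w, hwker⟩, hw0⟩ := Module.finrank_pos_iff_exists_ne_zero.mp hker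
  have hw : w ≠ 0 := fun h0 ↦ hw0 (Subtype.ext h0)
  have hfw : f w = 0 := LinearMap.mem_ker.mp hwker
  have hc : ∀ i, g₀ (u i) w = 0 := fun i ↦ by
    have e := congr_fun hfw i
    simpa [f] using e
  exact ⟨w, hw, hc 0, hc 1, hc 2, hc 3⟩

/-- **Headline.** On a quaternionic Hermitian vector space of real dimension `> 4` (i.e. `4m` with `m ≥ 2`),
**`ad J (ω_I ∧ ω_I) ≠ 0`**: the square of the Kähler form of `I` is not of type `(2,2)` for `J`. [folklore]
[cite: Verbitsky1996Hyperholomorphic, §1 Prop. 1.2 and §2 Lemma 2.1 (proof)] -/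
theorem adAlt_J_wedge_self_fundamentalForm_opI_ne_zero_of_finrank (h : IsLinearHyperkaehler g₀ J)
    [FiniteDimensional ℝ E] (hdim : 4 < Module.finrank ℝ E) :
    adAlt J ((fundamentalForm g₀ (opI E)).wedge (fundamentalForm g₀ (opI E))) ≠ 0 := by
  obtain ⟨v, hv⟩ := (Module.finrank_pos_iff_exists_ne_zero (R := ℝ) (M := E)).mp (by omega)
  obtain ⟨w, hw, hvw, hIvw, hJvw, hKvw⟩ := exists_ne_zero_hOrthogonal (g₀ := g₀) (J := J) hdim v
  exact h.adAlt_J_wedge_self_fundamentalForm_opI_ne_zero hv hw hvw hIvw hJvw hKvw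

/-- **`ω_I ∧ ω_I` is not `𝔤_M`-trivial** (`𝔤_M = 𝔰𝔲(2)` the isotropy algebra; the tree's rendering of
"`G_M`-invariant" is `ad I β = 0 ∧ ad J β = 0`) in real dimension `> 4`. [folklore]
[cite: Verbitsky1996Hyperholomorphic, §1 Prop. 1.2 and §2 Lemma 2.1 (proof)] -/
theorem not_su2Trivial_wedge_self_fundamentalForm_opI (h : IsLinearHyperkaehler g₀ J) [FiniteDimensional ℝ E]
    (hdim : 4 < Module.finrank ℝ E) :
    ¬ (adAlt (opI E) ((fundamentalForm g₀ (opI E)).wedge (fundamentalForm g₀ (opI E))) = 0 ∧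
        adAlt J ((fundamentalForm g₀ (opI E)).wedge (fundamentalForm g₀ (opI E))) = 0) :=
  fun hIJ ↦ h.adAlt_J_wedge_self_fundamentalForm_opI_ne_zero_of_finrank hdim hIJ.2

/-- **Group level: `ω_I ∧ ω_I` is not invariant under the isotropy group `G_M = SU(2)`** of unit quaternions
`q = a + bI + cJ + dK` acting diagonally (`β ↦ β(q·, q·, q·, q·)`), in real dimension `> 4` — by
`forall_compContinuousLinearMap_quaternion_iff` (Prop. 1.1/1.2: `SU(2)`-invariant iff `𝔤_M`-trivial). [folklore]
[cite: Verbitsky1996Hyperholomorphic, §1 Prop. 1.1 and Prop. 1.2; §2 Lemma 2.1 (proof: "no section of R is G_M-invariant")] -/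
theorem not_forall_quaternion_invariant_wedge_self_fundamentalForm_opI (h : IsLinearHyperkaehler g₀ J)
    [FiniteDimensional ℝ E] (hdim : 4 < Module.finrank ℝ E) :
    ¬ ∀ a b c d : ℝ, a ^ 2 + b ^ 2 + c ^ 2 + d ^ 2 = 1 →
      ((fundamentalForm g₀ (opI E)).wedge (fundamentalForm g₀ (opI E))).compContinuousLinearMap
          (a • ContinuousLinearMap.id ℝ E + b • opI E + c • J + d • opK J) =
        (fundamentalForm g₀ (opI E)).wedge (fundamentalForm g₀ (opI E)) :=
  fun hq ↦ h.not_su2Trivial_wedge_self_fundamentalForm_opI hdim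
    (h.forall_compContinuousLinearMap_quaternion_iff.mp hq)

end IsLinearHyperkaehler

/-! ## §4 Any Kähler class: `ad J (h ∧ h) ≠ 0` for every `I`-positive `(1,1)`-form `h` (hard Lefschetz route) -/

section AnyKaehlerClass

variable {E : Type*} [NormedAddCommGroup E] [NormedSpace ℂ E] [FiniteDimensional ℂ E]
  {g₀ : E →L[ℝ] E →L[ℝ] ℝ} {J : E →L[ℝ] E}

open Literature.Geometry.Kaehler Literature.Geometry.Kaehler.ComplexTorus in
/-- **Lefschetz step.** For a NON-DEGENERATE real `2`-form `h` on a complex vector space of dimension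
`≥ 3` and a real `2`-form `η`: `h ∧ η = 0 ⟹ η = 0` (injectivity of `η ↦ h ∧ η` on `2`-forms; the tree's
pointwise hard Lefschetz `ComplexTorus.eq_zero_of_wedgePow_wedge_eq_zero` with `k = 2`, `j = dim − 2 ≥ 1`,
after `h^{∧(j)} ∧ η = h^{∧(j−1)} ∧ (h ∧ η)` by associativity). [cite: Voisin2002, Lemma 6.20]
[cite: Lange2023AbelianVarietiesComplex, §7.3.2 (1)] -/
theorem eq_zero_of_two_wedge_two_eq_zero {h η : E [⋀^Fin 2]→L[ℝ] ℝ}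
    (hnd : ∀ v : E, v ≠ 0 → ∃ w : E, h ![v, w] ≠ 0) (hdim : 3 ≤ Module.finrank ℂ E)
    (h0 : h.wedge η = 0) : η = 0 := by
  obtain ⟨p, hp⟩ : ∃ p : ℕ, 2 + (p + 1) = Module.finrank ℂ E := ⟨Module.finrank ℂ E - 3, by omega⟩
  have hw : (wedgePow (ofRealForm h) (p + 1)).wedge (ofRealForm η) = 0 := by
    rw [wedgePow_succ, ContinuousAlternatingMap.WedgeAssoc_holds ℝ E ℂ, ← ofRealForm_wedge, h0,
      ComplexTorus.ofRealForm_zero, ContinuousAlternatingMap.wedge_zero]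
    rfl
  have hη : ofRealForm η = 0 := eq_zero_of_wedgePow_wedge_eq_zero hnd hp hw
  exact ofRealForm_injective (hη.trans ComplexTorus.ofRealForm_zero.symm)

/-- **The positivity sub-lemma, pointwise, for ANY Kähler class.** Let `J` be a second complex structure on
the complex vector space `(E, I = i•)` anticommuting with `I` (`J² = −1`, `JI = −IJ`; with `K = IJ` the unit
quaternions in `I, J, K` form Verbitsky's isotropy group `G_M = SU(2)` of any hyperkähler metric inducing
`I, J`), `dim_ℂ E ≥ 3` (so `≥ 4`), and let `h` be ANY real `2`-form which is `I`-positive (`h(v, Iv) > 0` for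
`v ≠ 0`) — e.g. the constant representative of an arbitrary Kähler class of a flat complex torus `E/Λ` (a
positive real `(1,1)`-form; the type-`(1,1)` hypothesis itself is not needed, only positivity enters). Then
**`ad J (h ∧ h) ≠ 0`**: `h ∧ h` is not of type `(2,2)` for `J`, hence not
`𝔤_M`-trivial and (Prop. 1.2) not `G_M`-invariant. Proof: `ad J (h ∧ h) = 2 h ∧ ad J h` (Leibniz); if it
vanished, hard Lefschetz (`eq_zero_of_two_wedge_two_eq_zero`, `h` is non-degenerate) would give `ad J h = 0`,
i.e. `h(J·, J·) = h`; but then `h(Jv, I Jv) = −h(Jv, J(Iv)) = −h(v, Iv) < 0` for `v ≠ 0`, against positivity at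
`Jv`. [folklore] [cite: Verbitsky1996Hyperholomorphic, §1 Prop. 1.2 and §2 Lemma 2.1 (proof: "no section of R is G_M-invariant")]
[cite: Voisin2002, Lemma 6.20] -/
theorem adAlt_wedge_self_ne_zero_of_oneOne_pos (hJJ : ∀ v : E, J (J v) = -v)
    (hJI : ∀ v : E, J (I • v) = -(I • J v)) {h : E [⋀^Fin 2]→L[ℝ] ℝ}
    (hpos : ∀ v : E, v ≠ 0 → 0 < h ![v, I • v]) (hdim : 3 ≤ Module.finrank ℂ E) :
    adAlt J (h.wedge h) ≠ 0 := by
  intro h0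
  -- Leibniz: `ad J (h ∧ h) = 2 • (h ∧ ad J h)`
  have e : adAlt J (h.wedge h) = (2 : ℝ) • h.wedge (adAlt J h) := by
    rw [adAlt_wedge, Literature.Geometry.Kaehler.TwoForm.wedge_comm_two_two h (adAlt J h), two_smul]
  rw [e, smul_eq_zero] at h0
  have hwedge : h.wedge (adAlt J h) = 0 := h0.resolve_left (by norm_num)
  -- `h` is non-degenerate (positivity at `w = Iv`)
  have hnd : ∀ v : E, v ≠ 0 → ∃ w : E, h ![v, w] ≠ 0 :=
    fun v hv ↦ ⟨I • v, (hpos v hv).ne'⟩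
  -- hard Lefschetz: `ad J h = 0`, i.e. `h` is `J`-invariant
  have hη : adAlt J h = 0 := eq_zero_of_two_wedge_two_eq_zero hnd hdim hwedge
  have hJinv : ∀ v w : E, h ![J v, J w] = h ![v, w] := (IsLinearHyperkaehler.adAlt_eq_zero_iff_apply₂_invariant hJJ).mp hη
  -- a non-zero vector and the sign contradiction at `Jv`
  obtain ⟨v, hv⟩ := (Module.finrank_pos_iff_exists_ne_zero (R := ℂ) (M := E)).mp (by omega)
  have hJv : J v ≠ 0 := fun hz ↦ hv (by simpa [hz] using (hJJ v).symm)
  have h1 := hpos (J v) hJv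
  have h2 := hpos v hv
  have e2 : h ![J v, I • J v] = -h ![v, I • v] := by
    have hIJ : I • J v = -J (I • v) := by rw [hJI, neg_neg]
    rw [hIJ, apply₂_neg_right, hJinv]
  linarith

namespace IsLinearHyperkaehler

/-- **`h ∧ h` is not `𝔤_M`-trivial** for every `I`-positive real `2`-form `h` (e.g. a positive `(1,1)`-form = a
Kähler class) on the carrier of a linear hyperkähler structure `(g₀, I, J, K)` of complex dimension `≥ 3`
(`¬ (ad I (h∧h) = 0 ∧ ad J (h∧h) = 0)`).
[folklore] [cite: Verbitsky1996Hyperholomorphic, §1 Prop. 1.2 and §2 Lemma 2.1 (proof)] -/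
theorem not_su2Trivial_wedge_self_of_oneOne_pos (hk : IsLinearHyperkaehler g₀ J)
    {h : E [⋀^Fin 2]→L[ℝ] ℝ} (hpos : ∀ v : E, v ≠ 0 → 0 < h ![v, I • v])
    (hdim : 3 ≤ Module.finrank ℂ E) :
    ¬ (adAlt (opI E) (h.wedge h) = 0 ∧ adAlt J (h.wedge h) = 0) :=
  fun hIJ ↦ adAlt_wedge_self_ne_zero_of_oneOne_pos hk.J_J hk.J_I hpos hdim hIJ.2

/-- **Group level, any Kähler class: `h ∧ h` is not invariant under the isotropy group `G_M = SU(2)`** (unit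
quaternions `a + bI + cJ + dK` acting diagonally) for every `I`-positive real `2`-form `h` (in particular every
positive `(1,1)`-form), complex dimension `≥ 3` — on a flat complex torus `E/Λ` with any compatible (flat) hyperkähler structure this is the sentence
"`[h]²` is not `SU(2)`-invariant for every Kähler class `h`, `dim ≥ 4`" at the level of constant forms
(= cohomology of the torus). [folklore] [cite: Verbitsky1996Hyperholomorphic, §1 Prop. 1.1 and Prop. 1.2; §2 Lemma 2.1 (proof)] -/
theorem not_forall_quaternion_invariant_wedge_self_of_oneOne_pos (hk : IsLinearHyperkaehler g₀ J)
    {h : E [⋀^Fin 2]→L[ℝ] ℝ} (hpos : ∀ v : E, v ≠ 0 → 0 < h ![v, I • v])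
    (hdim : 3 ≤ Module.finrank ℂ E) :
    ¬ ∀ a b c d : ℝ, a ^ 2 + b ^ 2 + c ^ 2 + d ^ 2 = 1 →
      (h.wedge h).compContinuousLinearMap (a • ContinuousLinearMap.id ℝ E + b • opI E + c • J + d • opK J) =
        h.wedge h :=
  fun hq ↦ hk.not_su2Trivial_wedge_self_of_oneOne_pos hpos hdim
    (hk.forall_compContinuousLinearMap_quaternion_iff.mp hq)

/-- The Kähler form `ω_I` of `g₀` itself is `I`-positive, so §3 is the special case `h = ω_I` of §4 (recorded
as the implication, complex dimension `≥ 3`). [cite: Joyce2007, §10.1.1 eq. (10.1)] -/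
theorem adAlt_J_wedge_self_fundamentalForm_opI_ne_zero_of_finrank_complex (hk : IsLinearHyperkaehler g₀ J)
    (hdim : 3 ≤ Module.finrank ℂ E) :
    adAlt J ((fundamentalForm g₀ (opI E)).wedge (fundamentalForm g₀ (opI E))) ≠ 0 :=
  adAlt_wedge_self_ne_zero_of_oneOne_pos hk.J_J hk.J_I
    (fun v hv ↦ by rw [hk.fundamentalForm_I_apply, hk.inner_I]; exact hk.pos v hv) hdim

end IsLinearHyperkaehler

/-! ## §5 Consequently no non-zero multiple of `h ∧ h` is `𝔤_M`-trivial (the form in which the cell uses it: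
an `SU(2)`-invariant degree-`4` class proportional to `h²` vanishes) -/

omit [FiniteDimensional ℂ E] in
/-- Products of `ad T`-trivial forms are `ad T`-trivial (Leibniz): the Chern forms of a connection with
`𝔤_M`-trivial curvature entries are `𝔤_M`-trivial. [cite: Verbitsky1996Hyperholomorphic, §1 (definition of ad I; "Leibnitz formula") and Def. 2.4 ("its p-th Chern class is of type (p,p) with respect to any induced complex structure")] -/
theorem adAlt_wedge_eq_zero_of_eq_zero {A : Type*} [NormedCommRing A] [NormedAlgebra ℝ A] {k l : ℕ}
    {T : E →L[ℝ] E} {α : E [⋀^Fin k]→L[ℝ] A} {β : E [⋀^Fin l]→L[ℝ] A} (hα : adAlt T α = 0)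
    (hβ : adAlt T β = 0) : adAlt T (α.wedge β) = 0 := by
  rw [adAlt_wedge, hα, hβ, ContinuousAlternatingMap.zero_wedge, ContinuousAlternatingMap.wedge_zero, add_zero]

/-- **No non-zero multiple of `h ∧ h` is `ad J`-trivial** (`J² = −1`, `JI = −IJ`, `h` `I`-positive, `dim_ℂ ≥ 3`):
`ad J (c • h ∧ h) = 0 ⟹ c = 0` — the shape in which the positivity sub-lemma is applied ("`c₂ = −R q₂ [h²]` is
`SU(2)`-invariant, hence `q₂ = 0`"). [folklore] [cite: Verbitsky1996Hyperholomorphic, §1 Prop. 1.2 and §2 Lemma 2.1 (proof)] -/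
theorem eq_zero_of_adAlt_smul_wedge_self_eq_zero (hJJ : ∀ v : E, J (J v) = -v)
    (hJI : ∀ v : E, J (I • v) = -(I • J v)) {h : E [⋀^Fin 2]→L[ℝ] ℝ}
    (hpos : ∀ v : E, v ≠ 0 → 0 < h ![v, I • v]) (hdim : 3 ≤ Module.finrank ℂ E) {c : ℝ}
    (hc : adAlt J (c • h.wedge h) = 0) : c = 0 := by
  rw [map_smul, smul_eq_zero] at hc
  exact hc.resolve_right (adAlt_wedge_self_ne_zero_of_oneOne_pos hJJ hJI hpos hdim)

/-- The same at the group level on the carrier of a linear hyperkähler structure: **an `SU(2)`-invariant real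
multiple of `h ∧ h` is zero.** [folklore] [cite: Verbitsky1996Hyperholomorphic, §1 Prop. 1.1 and Prop. 1.2; §2 Lemma 2.1 (proof)] -/
theorem IsLinearHyperkaehler.eq_zero_of_forall_quaternion_invariant_smul_wedge_self
    (hk : IsLinearHyperkaehler g₀ J) {h : E [⋀^Fin 2]→L[ℝ] ℝ} (hpos : ∀ v : E, v ≠ 0 → 0 < h ![v, I • v])
    (hdim : 3 ≤ Module.finrank ℂ E) {c : ℝ}
    (hq : ∀ a b c' d : ℝ, a ^ 2 + b ^ 2 + c' ^ 2 + d ^ 2 = 1 →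
      (c • h.wedge h).compContinuousLinearMap (a • ContinuousLinearMap.id ℝ E + b • opI E + c' • J + d • opK J) =
        c • h.wedge h) : c = 0 :=
  eq_zero_of_adAlt_smul_wedge_self_eq_zero hk.J_J hk.J_I hpos hdim
    (hk.forall_compContinuousLinearMap_quaternion_iff.mp hq).2

/-! ## §6 Degree `2` (the shadow in `H²`): no `I`-positive `2`-form is `J`-invariant, hence none is `G_M`-invariant -/

omit [FiniteDimensional ℂ E] in
/-- **No `I`-positive real `2`-form is `ad J`-trivial** for a `J` with `J² = −1`, `JI = −IJ` on a non-zero space: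
`ad J h ≠ 0` — if `h(J·, J·) = h` then `h(Jv, I Jv) = −h(v, Iv) < 0`. This is the degree-`2` companion of §4
(no Kähler class of a flat torus is of type `(1,1)` along the twistor line: Verbitsky's Lemma 2.1 "no section of
`R` is `G_M`-invariant" / invariant `2`-forms are primitive; Buskin–Izadi: "Kähler classes on complex tori do not
stay of Hodge type in twistor families"). [cite: Verbitsky1996Hyperholomorphic, §2 Lemma 2.1 (proof)] -/
theorem adAlt_ne_zero_of_pos (hJJ : ∀ v : E, J (J v) = -v) (hJI : ∀ v : E, J (I • v) = -(I • J v))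
    {h : E [⋀^Fin 2]→L[ℝ] ℝ} (hpos : ∀ v : E, v ≠ 0 → 0 < h ![v, I • v]) {v : E} (hv : v ≠ 0) :
    adAlt J h ≠ 0 := by
  intro hη
  have hJinv : ∀ v w : E, h ![J v, J w] = h ![v, w] :=
    (IsLinearHyperkaehler.adAlt_eq_zero_iff_apply₂_invariant hJJ).mp hη
  have hJv : J v ≠ 0 := fun hz ↦ hv (by simpa [hz] using (hJJ v).symm)
  have h1 := hpos (J v) hJv
  have h2 := hpos v hv
  have e2 : h ![J v, I • J v] = -h ![v, I • v] := by
    have hIJ : I • J v = -J (I • v) := by rw [hJI, neg_neg]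
    rw [hIJ, apply₂_neg_right, hJinv]
  linarith

omit [FiniteDimensional ℂ E] in
/-- **Group level, degree `2`: an `I`-positive real `2`-form (a Kähler class) is not invariant under the
isotropy group `G_M = SU(2)`** of a linear hyperkähler structure on a non-zero space — the pointwise form of
"Kähler classes on complex tori do not stay of Hodge type in twistor families" and of the `c₁`-constraint for
bundles extending to the twistor family. [cite: Verbitsky1996Hyperholomorphic, §1 Prop. 1.2 and §2 Lemma 2.1 (proof)] -/
theorem IsLinearHyperkaehler.not_forall_quaternion_invariant_of_pos (hk : IsLinearHyperkaehler g₀ J)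
    {h : E [⋀^Fin 2]→L[ℝ] ℝ} (hpos : ∀ v : E, v ≠ 0 → 0 < h ![v, I • v]) {v : E} (hv : v ≠ 0) :
    ¬ ∀ a b c d : ℝ, a ^ 2 + b ^ 2 + c ^ 2 + d ^ 2 = 1 →
      h.compContinuousLinearMap (a • ContinuousLinearMap.id ℝ E + b • opI E + c • J + d • opK J) = h :=
  fun hq ↦ adAlt_ne_zero_of_pos hk.J_J hk.J_I hpos hv (hk.forall_compContinuousLinearMap_quaternion_iff.mp hq).2

end AnyKaehlerClass

end Literature.Geometry.Hyperkaehler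

end
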